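import Literature.Barriers.AtomisticToContinuum.HardDiskGibbsKernel
import Literature.Barriers.AtomisticToContinuum.HardDiskTranslationCriterion
import Mathlib.Probability.Kernel.MeasurableLIntegral
import Mathlib.MeasureTheory.Measure.SeparableMeasure
import Mathlib.MeasureTheory.SetAlgebra
import HarnessLib

/-!
# The hard-disc specification: properness, the proper Markov kernel `γ_Λ`, and the σ-algebras
# `𝓕_{𝒳,Λᶜ}`, `𝓕_{𝒳,∞}` of the setting (Richthammer 2007, §3.2–3.3)

Groundwork for the proof of Richthammer's Lemma 5 (`Richthammer2007_lemma5`, file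
`HardDiskTranslationInvarianceSteps.lean`), on top of `HardDiskGibbsMeasurability.lean` and
`HardDiskGibbsKernel.lean` (measurability, finiteness of `Z_Λ`, `exists_gibbs_kernel`,
(3.1) for functions). No new definitions: σ-algebras are written out
(`𝓕_{𝒳,Λ} = MeasurableSpace.comap (PointConfig.restrict Λ) _`, so that
`D ∈ 𝓕_{𝒳,Λ} ↔ IsCylinderEvent Λ D` definitionally, and a tail event `T ∈ 𝓕_{𝒳,∞} = ⋂_m 𝓕_{𝒳,Λ_mᶜ}`
is `∀ m : ℕ, IsCylinderEvent (Λ_m)ᶜ T`), and the kernel is produced existentially.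

* **Properness** ("`γ_Λ` is a probability kernel from `(𝒳, 𝓕_{𝒳,Λᶜ})`", §3.3, p. 7):
  `weight_inter_preimage` / `gibbsKernel_inter_preimage` — `γ_Λ(A ∩ B|Y) = 1_B(Y) γ_Λ(A|Y)` for
  `B = e_{Λᶜ}⁻¹(C) ∈ 𝓕_{𝒳,Λᶜ}` (no measurability needed); `weight_restrict_compl` /
  `gibbsKernel_restrict_compl` — `γ_Λ(·|Y)` depends on `Y_{Λᶜ}` only;
* `exists_gibbsSpec` — the Markov kernel of `exists_gibbs_kernel` is proper: it factors through
  `e_{Λᶜ}`, `𝓕_{Λᶜ}`-measurable factors come out of its integrals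
  (`∫ γ_Λ(dX|Y) h(X_{Λᶜ}) G(X) = h(Y_{Λᶜ}) ∫ γ_Λ(dX|Y) G(X)`), and it realises the DLR equation
  (3.1) for functions, `∫ μ(dX) g(X) = ∫ μ(dY) ∫ γ_Λ(dX|Y) g(X)`;
* the σ-algebras of §3.2: `measurable_comp_restrict` (`F ∘ e_Λ` is `𝓕_{𝒳,Λ}`-measurable),
  `exists_subset_box`, `isCylinderEvent_compl_of_forall_box` (`𝓕_{𝒳,∞} ⊆ 𝓕_{𝒳,Λᶜ}` for bounded
  `Λ`), `measurableSet_of_forall_isCylinderEvent_compl_box` (tail events are events),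
  `iInf_comap_restrict_compl_box_le` (membership `T ∈ ⋂_m 𝓕_{𝒳,Λ_mᶜ} ↔ ∀ m, IsCylinderEvent (Λ_m)ᶜ T`
  is Mathlib's `MeasurableSpace.measurableSet_iInf`, definitionally);
* the algebra of cylinder events `⋃_m 𝓕_{𝒳,Λ_m}` (§3.5, §4.3): `isSetAlgebra_cylinderEvents` and
  the **monotone-class step of Lemma 5**, `measure_le_of_forall_cylinderEvents`: an inequality
  `μ ≤ ρ` between finite measures on cylinder events holds on all of `𝓕_𝒳` (via Mathlib's
  `Measure.MeasureDense.of_generateFrom_isSetAlgebra_finite` and the tree's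
  `generateFrom_cylinderEvents`);
* `translate_translate_neg`, `translate_neg_translate` — `g_{-v} ∘ g_v = id`.

## References

* T. Richthammer, *Translation-invariance of two-dimensional Gibbsian point processes*, Comm.
  Math. Phys. 274 (2007) 81–122, arXiv:0706.3637: §3.2 (p. 6), §3.3 Definition 2, (3.1) (p. 7),
  §3.5 (p. 8), §4.3 (p. 10).
* S. Friedli, Y. Velenik, *Statistical Mechanics of Lattice Systems*, CUP 2017, §6.2–6.3
  (specifications: properness, consistency) — the lattice blueprint of the notions used here.
-/

noncomputable section

open MeasureTheory Set ProbabilityTheory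
open scoped ENNReal symmDiff

namespace Literature.Barriers.AtomisticToContinuum.HardDisk

open Literature.Analysis.FunctionSpaces

/-! ### Properness on events (no measurability needed) -/

/-- Properness, pointwise: the integrand of `weight(A ∩ B)` for `B = e_{Λᶜ}⁻¹(C)` is `1_B(Y)` times
that of `weight(A)`. [cite: Richthammer2007, §3.3 (p. 7)] -/
theorem indicator_inter_preimage_superpose (Λ : Set (EuclideanSpace ℝ (Fin 2))) {k : ℕ} (x : Fin k → (EuclideanSpace ℝ (Fin 2))) (Y : PointConfig (EuclideanSpace ℝ (Fin 2)))
    (A C : Set (PointConfig (EuclideanSpace ℝ (Fin 2)))) :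
    (A ∩ PointConfig.restrict Λᶜ ⁻¹' C ∩ {X | HardCoreIn Λ X}).indicator (1 : PointConfig (EuclideanSpace ℝ (Fin 2)) → ℝ≥0∞)
        (superpose Λ x Y) =
      (PointConfig.restrict Λᶜ ⁻¹' C).indicator 1 Y *
        (A ∩ {X | HardCoreIn Λ X}).indicator 1 (superpose Λ x Y) := by
  by_cases hY : Y ∈ PointConfig.restrict Λᶜ ⁻¹' C
  · have hx : superpose Λ x Y ∈ PointConfig.restrict Λᶜ ⁻¹' C := by
      rw [mem_preimage, restrict_compl_superpose]
      exact hY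
    rw [Set.indicator_of_mem hY, Pi.one_apply, one_mul]
    by_cases h2 : superpose Λ x Y ∈ A ∩ {X | HardCoreIn Λ X}
    · have h3 : superpose Λ x Y ∈ A ∩ PointConfig.restrict Λᶜ ⁻¹' C ∩ {X | HardCoreIn Λ X} :=
        ⟨⟨h2.1, hx⟩, h2.2⟩
      rw [Set.indicator_of_mem h2, Set.indicator_of_mem h3]
    · rw [Set.indicator_of_notMem h2, Set.indicator_of_notMem (fun h => h2 ⟨h.1.1, h.2⟩)]
  · have hx : superpose Λ x Y ∉ PointConfig.restrict Λᶜ ⁻¹' C := by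
      rw [mem_preimage, restrict_compl_superpose]
      exact hY
    rw [Set.indicator_of_notMem hY, zero_mul, Set.indicator_of_notMem (fun h => hx h.1.2)]

/-- **Properness on events**: `weight(A ∩ B) = 1_B(Y) · weight(A)` for `B = e_{Λᶜ}⁻¹(C) ∈ 𝓕_{𝒳,Λᶜ}`.
[cite: Richthammer2007, §3.3 (p. 7)] -/
theorem weight_inter_preimage (z : ℝ) (Λ : Set (EuclideanSpace ℝ (Fin 2))) (Y : PointConfig (EuclideanSpace ℝ (Fin 2))) (A C : Set (PointConfig (EuclideanSpace ℝ (Fin 2)))) :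
    weight z Λ Y (A ∩ PointConfig.restrict Λᶜ ⁻¹' C) =
      (PointConfig.restrict Λᶜ ⁻¹' C).indicator 1 Y * weight z Λ Y A := by
  have hc : (PointConfig.restrict Λᶜ ⁻¹' C).indicator (1 : PointConfig (EuclideanSpace ℝ (Fin 2)) → ℝ≥0∞) Y ≠ ∞ := by
    by_cases hY : Y ∈ PointConfig.restrict Λᶜ ⁻¹' C
    · rw [Set.indicator_of_mem hY, Pi.one_apply]
      exact ENNReal.one_ne_top
    · rw [Set.indicator_of_notMem hY]
      exact ENNReal.zero_ne_top
  unfold weight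
  simp_rw [indicator_inter_preimage_superpose, lintegral_const_mul' _ _ hc, ← ENNReal.tsum_mul_left]
  refine tsum_congr fun k => ?_
  ring

/-- **Properness of `γ_Λ` on events**: `γ_Λ(A ∩ B|Y) = 1_B(Y) γ_Λ(A|Y)` for
`B = e_{Λᶜ}⁻¹(C) ∈ 𝓕_{𝒳,Λᶜ}`. [cite: Richthammer2007, §3.3 (p. 7)] -/
theorem gibbsKernel_inter_preimage (z : ℝ) (Λ : Set (EuclideanSpace ℝ (Fin 2))) (Y : PointConfig (EuclideanSpace ℝ (Fin 2))) (A C : Set (PointConfig (EuclideanSpace ℝ (Fin 2)))) :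
    gibbsKernel z Λ Y (A ∩ PointConfig.restrict Λᶜ ⁻¹' C) =
      (PointConfig.restrict Λᶜ ⁻¹' C).indicator 1 Y * gibbsKernel z Λ Y A := by
  rw [gibbsKernel, gibbsKernel, weight_inter_preimage, mul_div_assoc]

/-- The weights depend on the boundary condition outside `Λ` only. [cite: Richthammer2007, §3.2–3.3 (pp. 6–7)] -/
theorem weight_restrict_compl (z : ℝ) (Λ : Set (EuclideanSpace ℝ (Fin 2))) (Y : PointConfig (EuclideanSpace ℝ (Fin 2))) (A : Set (PointConfig (EuclideanSpace ℝ (Fin 2)))) :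
    weight z Λ (Y.restrict Λᶜ) A = weight z Λ Y A := by
  unfold weight
  simp_rw [superpose_restrict_compl]

/-- `γ_Λ(A|Y_{Λᶜ}) = γ_Λ(A|Y)`: the kernel factors through the restriction map `e_{Λᶜ}`.
[cite: Richthammer2007, §3.3 (p. 7)] -/
theorem gibbsKernel_restrict_compl (z : ℝ) (Λ : Set (EuclideanSpace ℝ (Fin 2))) (Y : PointConfig (EuclideanSpace ℝ (Fin 2))) (A : Set (PointConfig (EuclideanSpace ℝ (Fin 2)))) :
    gibbsKernel z Λ (Y.restrict Λᶜ) A = gibbsKernel z Λ Y A := by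
  rw [gibbsKernel, gibbsKernel, weight_restrict_compl, weight_restrict_compl]

/-! ### The proper Markov kernel `γ_Λ` and the DLR equation for functions -/

/-- **`γ_Λ` as a proper Markov kernel realising (3.1).** For every real `z` and bounded measurable
`Λ` there is a Markov kernel `κ` on `𝒳` with `κ Y A = γ_Λ(A|Y)` on events, which (i) factors
through `e_{Λᶜ}` (`κ (Y_{Λᶜ}) = κ Y`), (ii) is proper —
`∫ κ(dX|Y) h(X_{Λᶜ}) G(X) = h(Y_{Λᶜ}) ∫ κ(dX|Y) G(X)` for measurable `h, G ≥ 0` — and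
(iii) satisfies the DLR equation for functions, `∫ μ(dX) g(X) = ∫ μ(dY) ∫ κ(dX|Y) g(X)` for every
Gibbs measure `μ` at activity `z` and measurable `g ≥ 0` (the kernel of `exists_gibbs_kernel`).
[cite: Richthammer2007, §3.3 (p. 7, "`γ_Λ` is a probability kernel from `(𝒳𝒳,𝓕_{𝒳𝒳,Λᶜ})`" and (3.1))] -/
theorem exists_gibbsSpec (z : ℝ) {Λ : Set (EuclideanSpace ℝ (Fin 2))} (hΛ : MeasurableSet Λ) (hb : Bornology.IsBounded Λ) :
    ∃ κ : Kernel (PointConfig (EuclideanSpace ℝ (Fin 2))) (PointConfig (EuclideanSpace ℝ (Fin 2))), IsMarkovKernel κ ∧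
      (∀ (Y : PointConfig (EuclideanSpace ℝ (Fin 2))) (A : Set (PointConfig (EuclideanSpace ℝ (Fin 2)))), MeasurableSet A → κ Y A = gibbsKernel z Λ Y A) ∧
      (∀ Y : PointConfig (EuclideanSpace ℝ (Fin 2)), κ (Y.restrict Λᶜ) = κ Y) ∧
      (∀ (Y : PointConfig (EuclideanSpace ℝ (Fin 2))) (h G : PointConfig (EuclideanSpace ℝ (Fin 2)) → ℝ≥0∞), Measurable h → Measurable G →
        ∫⁻ X, h (X.restrict Λᶜ) * G X ∂(κ Y) = h (Y.restrict Λᶜ) * ∫⁻ X, G X ∂(κ Y)) ∧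
      (∀ μ : Measure (PointConfig (EuclideanSpace ℝ (Fin 2))), IsGibbs z μ → ∀ g : PointConfig (EuclideanSpace ℝ (Fin 2)) → ℝ≥0∞, Measurable g →
        ∫⁻ X, g X ∂μ = ∫⁻ Y, ∫⁻ X, g X ∂(κ Y) ∂μ) := by
  obtain ⟨κ, hM, hA, hg, hbind⟩ := exists_gibbs_kernel z hΛ hb
  refine ⟨κ, hM, hA, fun Y => ?_, fun Y h G hh hG => ?_, fun μ hμ g hmg => ?_⟩
  · ext A hA'
    rw [hA _ _ hA', hA _ _ hA', gibbsKernel_restrict_compl]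
  · have hhG : Measurable fun X : PointConfig (EuclideanSpace ℝ (Fin 2)) => h (X.restrict Λᶜ) * G X :=
      (hh.comp (PointConfig.measurable_restrict hΛ.compl)).mul hG
    rw [hg Y _ hhG, hg Y _ hG]
    simp_rw [restrict_compl_superpose]
    have hk : ∀ k : ℕ, ∫⁻ x in {x | HardCoreIn Λ (superpose Λ x Y)}, h (Y.restrict Λᶜ) * G (superpose Λ x Y)
        ∂(Measure.pi fun _ : Fin k => (volume : Measure (EuclideanSpace ℝ (Fin 2))).restrict Λ) =
        h (Y.restrict Λᶜ) * ∫⁻ x in {x | HardCoreIn Λ (superpose Λ x Y)}, G (superpose Λ x Y)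
          ∂(Measure.pi fun _ : Fin k => (volume : Measure (EuclideanSpace ℝ (Fin 2))).restrict Λ) := fun k => by
      have hGS : Measurable fun a : Fin k → (EuclideanSpace ℝ (Fin 2)) => G (superpose Λ a Y) :=
        hG.comp (measurable_superpose_left hΛ k Y)
      rw [lintegral_const_mul _ hGS]
    simp_rw [hk, ← mul_assoc _ (h (Y.restrict Λᶜ)), mul_comm _ (h (Y.restrict Λᶜ)), mul_assoc,
      ENNReal.tsum_mul_left, mul_div_assoc]
  · conv_lhs => rw [← hbind μ hμ]
    rw [Measure.lintegral_bind (Kernel.measurable κ).aemeasurable hmg.aemeasurable]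

/-! ### The σ-algebras `𝓕_{𝒳,Λ}` and `𝓕_{𝒳,∞}` (Richthammer 2007, §3.2), written out -/

/-- A function of `X_Λ` is `𝓕_{𝒳,Λ}`-measurable: `F ∘ e_Λ` is measurable for the pull-back
σ-algebra `𝓕_{𝒳,Λ} = e_Λ⁻¹ 𝓕'_{𝒳,Λ}` whenever `F` is measurable. [cite: Richthammer2007, §3.2 (p. 6)] -/
theorem measurable_comp_restrict {β : Type*} [MeasurableSpace β] {F : PointConfig (EuclideanSpace ℝ (Fin 2)) → β}
    (hF : Measurable F) (Λ : Set (EuclideanSpace ℝ (Fin 2))) :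
    Measurable[MeasurableSpace.comap (PointConfig.restrict Λ) PointConfig.instMeasurableSpace]
      (F ∘ PointConfig.restrict Λ) :=
  hF.comp (measurable_iff_comap_le.2 le_rfl)

/-- Every bounded set lies in some box `Λ_m`, `m ∈ ℕ`. [folklore] -/
theorem exists_subset_box {Λ : Set (EuclideanSpace ℝ (Fin 2))} (hb : Bornology.IsBounded Λ) : ∃ m : ℕ, Λ ⊆ box (m : ℝ) := by
  obtain ⟨R, hR⟩ := (Metric.isBounded_iff_subset_closedBall (0 : (EuclideanSpace ℝ (Fin 2)))).1 hb
  obtain ⟨m, hm⟩ := exists_nat_gt R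
  refine ⟨m, fun x hx i => ?_⟩
  have hxR : ‖x‖ ≤ R := by simpa [dist_zero_right] using hR hx
  have hi : |x i| ≤ ‖x‖ := by simpa [Real.norm_eq_abs] using PiLp.norm_apply_le x i
  constructor
  · linarith [neg_abs_le (x i)]
  · linarith [le_abs_self (x i)]

/-- **`𝓕_{𝒳,∞} ⊆ 𝓕_{𝒳,Λᶜ}` for bounded `Λ`**: a tail event (an event in `𝓕_{𝒳,Λ_mᶜ}` for every
`m ∈ ℕ`) is an event outside every bounded window. [cite: Richthammer2007, §3.2 (p. 6)] -/
theorem isCylinderEvent_compl_of_forall_box {T : Set (PointConfig (EuclideanSpace ℝ (Fin 2)))}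
    (hT : ∀ m : ℕ, IsCylinderEvent (box (m : ℝ))ᶜ T) {Λ : Set (EuclideanSpace ℝ (Fin 2))} (hb : Bornology.IsBounded Λ) :
    IsCylinderEvent Λᶜ T := by
  obtain ⟨m, hm⟩ := exists_subset_box hb
  exact (hT m).mono (measurableSet_box _).compl (compl_subset_compl.2 hm)

/-- Tail events are events (`𝓕_{𝒳,∞} ⊆ 𝓕_𝒳`). [cite: Richthammer2007, §3.2 (p. 6)] -/
theorem measurableSet_of_forall_isCylinderEvent_compl_box {T : Set (PointConfig (EuclideanSpace ℝ (Fin 2)))}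
    (hT : ∀ m : ℕ, IsCylinderEvent (box (m : ℝ))ᶜ T) : MeasurableSet T :=
  (hT 0).measurableSet (measurableSet_box _).compl

/-- The tail σ-algebra `𝓕_{𝒳,∞} = ⋂_m 𝓕_{𝒳,Λ_mᶜ}` is a sub-σ-algebra of `𝓕_𝒳`.
[cite: Richthammer2007, §3.2 (p. 6)] -/
theorem iInf_comap_restrict_compl_box_le :
    (⨅ m : ℕ, MeasurableSpace.comap (PointConfig.restrict (box (m : ℝ))ᶜ)
      (PointConfig.instMeasurableSpace : MeasurableSpace (PointConfig (EuclideanSpace ℝ (Fin 2))))) ≤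
      PointConfig.instMeasurableSpace :=
  (iInf_le _ 0).trans (measurable_iff_comap_le.1 (PointConfig.measurable_restrict (measurableSet_box _).compl))

/-! ### The algebra of cylinder events; the monotone-class step of Lemma 5 -/

/-- The cylinder events `⋃_m 𝓕_{𝒳,Λ_m}` form an algebra of sets (an increasing union of
σ-algebras; "the algebra of all cylinder events"). [cite: Richthammer2007, §4.3 (p. 10)] -/
theorem isSetAlgebra_cylinderEvents :
    IsSetAlgebra (⋃ m : ℕ, {D : Set (PointConfig (EuclideanSpace ℝ (Fin 2))) | IsCylinderEvent (box m) D}) where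
  empty_mem := mem_iUnion.2 ⟨0, @MeasurableSet.empty _ (MeasurableSpace.comap _ _)⟩
  compl_mem := fun D hD => by
    obtain ⟨m, hm⟩ := mem_iUnion.1 hD
    exact mem_iUnion.2 ⟨m, MeasurableSet.compl (m := MeasurableSpace.comap _ _) hm⟩
  union_mem := fun D D' hD hD' => by
    obtain ⟨m, hm⟩ := mem_iUnion.1 hD
    obtain ⟨m', hm'⟩ := mem_iUnion.1 hD'
    exact mem_iUnion.2 ⟨max m m', @MeasurableSet.union _ (MeasurableSpace.comap _ _) _ _
      (IsCylinderEvent.mono (measurableSet_box _) (box_mono (by exact_mod_cast le_max_left m m')) hm)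
      (IsCylinderEvent.mono (measurableSet_box _) (box_mono (by exact_mod_cast le_max_right m m')) hm')⟩

/-- **Monotone-class step of Lemma 5**: if two finite measures satisfy `μ(D) ≤ ρ(D)` for all
cylinder events `D ∈ 𝓕_{𝒳,Λ_m}`, `m ∈ ℕ`, then `μ(A) ≤ ρ(A)` for all events `A` ("by the monotone
class theorem this inequality even holds on all of `𝓕_𝒳`"; here by approximating `A` in
`(μ + ρ)`-measure by cylinder events, a generating algebra). [cite: Richthammer2007, §4.3 (p. 10)] -/
theorem measure_le_of_forall_cylinderEvents {μ ρ : Measure (PointConfig (EuclideanSpace ℝ (Fin 2)))} [IsFiniteMeasure μ]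
    [IsFiniteMeasure ρ]
    (h : ∀ (m : ℕ) (D : Set (PointConfig (EuclideanSpace ℝ (Fin 2)))), IsCylinderEvent (box m) D → μ D ≤ ρ D)
    {A : Set (PointConfig (EuclideanSpace ℝ (Fin 2)))} (hA : MeasurableSet A) : μ A ≤ ρ A := by
  have hd : (μ + ρ).MeasureDense (⋃ m : ℕ, {D : Set (PointConfig (EuclideanSpace ℝ (Fin 2))) | IsCylinderEvent (box m) D}) :=
    Measure.MeasureDense.of_generateFrom_isSetAlgebra_finite (μ + ρ) isSetAlgebra_cylinderEvents
      generateFrom_cylinderEvents.symm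
  refine ENNReal.le_of_forall_pos_le_add fun ε hε _ => ?_
  have hε2 : (0 : ℝ) < ε / 2 := by positivity
  obtain ⟨D, hD, hAD⟩ := hd.approx A hA (measure_ne_top _ _) (ε / 2) hε2
  obtain ⟨m, hm⟩ := mem_iUnion.1 hD
  have hDm : MeasurableSet D := hm.measurableSet (measurableSet_box _)
  have hμs : μ (A ∆ D) ≤ ENNReal.ofReal (ε / 2) :=
    (le_trans (by rw [Measure.add_apply]; exact le_self_add) hAD.le)
  have hρs : ρ (A ∆ D) ≤ ENNReal.ofReal (ε / 2) :=
    (le_trans (by rw [Measure.add_apply]; exact le_add_self) hAD.le)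
  have hAD1 : A \ D ⊆ A ∆ D := fun x hx => Set.mem_symmDiff.2 (Or.inl hx)
  have hAD2 : D \ A ⊆ A ∆ D := fun x hx => Set.mem_symmDiff.2 (Or.inr hx)
  calc μ A = μ (A ∩ D) + μ (A \ D) := (measure_inter_add_sdiff _ hDm).symm
    _ ≤ μ D + μ (A ∆ D) := add_le_add (measure_mono inter_subset_right) (measure_mono hAD1)
    _ ≤ ρ D + ENNReal.ofReal (ε / 2) := add_le_add (h m D hm) hμs
    _ = ρ (D ∩ A) + ρ (D \ A) + ENNReal.ofReal (ε / 2) := by rw [measure_inter_add_sdiff _ hA]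
    _ ≤ ρ A + ENNReal.ofReal (ε / 2) + ENNReal.ofReal (ε / 2) :=
        add_le_add (add_le_add (measure_mono inter_subset_right) ((measure_mono hAD2).trans hρs)) le_rfl
    _ = ρ A + ε := by
        rw [add_assoc, ← ENNReal.ofReal_add hε2.le hε2.le, add_halves, ENNReal.ofReal_coe_nnreal]

/-! ### Translations compose to the identity -/

/-- `g_{-v} (g_v X) = X`. [folklore] -/
theorem translate_translate_neg (v : (EuclideanSpace ℝ (Fin 2))) (c : PointConfig (EuclideanSpace ℝ (Fin 2))) : (c.translate v).translate (-v) = c := by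
  rw [PointConfig.translate_translate, add_neg_cancel]
  exact congrFun PointConfig.translate_zero_eq_id c

/-- `g_v (g_{-v} X) = X`. [folklore] -/
theorem translate_neg_translate (v : (EuclideanSpace ℝ (Fin 2))) (c : PointConfig (EuclideanSpace ℝ (Fin 2))) : (c.translate (-v)).translate v = c := by
  rw [PointConfig.translate_translate, neg_add_cancel]
  exact congrFun PointConfig.translate_zero_eq_id c

end Literature.Barriers.AtomisticToContinuum.HardDisk

end
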